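import Summits.QuantumFields.BalabanUV.T4Continuum.Support.CTGaugeUnitDatum

/-!
# T⁴ programme, spine node NE2 (U1a), sub-row Δ3 «NE2-WALK» (T4-DAG `T4-U1a.S-NE2-D3-WALK°`) — THE GAUGE SLOT UNDER CONJUGATION IN
# DIFFERENCE FORM, part 1: the conjugated DIFFERENCES `c(Q′_U) − c(Q′_1)`, `c(W)`, `c(Y_U − Y_1)`, `c(G′_U) − c(G′_1)`, `c(Z_U) − c(Z_1)` are
# `O(α + τ)` — they VANISH with the background (file E5a of «Δ3-CT-HBD-B4-DIFF»)

NE2 formalisation swarm `b2b-balaban-t4-ne2-formalise-*`, leaf prover 06 (gen 3), supplier item «Δ3-CT-HBD-B4-DIFF» file E5a (chain «Δ3-CT» …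
«Δ3-CT-HKU», files A–E4).  File E3 bounded the two families' gauge sandwiches SEPARATELY, so its `kappa4CT` does not vanish with the background and
the coupling condition cannot reach `t = 1`.  Row B4's own (un-conjugated) route bounds the DIFFERENCE `gaugeP_U − gaugeP_1` by numbers that vanish
with the background (`GaugeTermPerturbationLaw`); THIS FILE transports that telescoping under the Combes–Thomas conjugation, at one level `n`, for
a family `(R, T)` (sizes `‖n(R − 1)‖ ≤ α`, `‖T − 1‖ ≤ τ`) against the free family `(1, 1)`:
 * §1 **`opNorm_conjMat_defect_le`** (`‖c(W)‖ ≤ dα·e^{|κ|}`, `W = D_R − ∂⊗1 = defect`; C1's `opNorm_conjMat_shiftM_le`), `opNorm_conjMat_defectH_le`,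
   **`opNorm_conjMat_Qu_sub_Q1_le`** (`‖c(Q′_U) − c(Q′_1)‖ ≤ e^{|κ|}τ`), `opNorm_conjMat_QuH_sub_Q1H_le`, **`opNorm_conjMat_massDiff_le`**
   (`‖c(Y_U − Y_1)‖ ≤ a′e^{|κ|}τ(2 + τ)`);
 * §2 **`opNorm_conjMat_green_diff_le`**: `‖c(G′_U) − c(G′_1)‖ ≤ dGc` by the resolvent identity `G′_U − G′_1 = G′_U(S_1 − S_U)G′_1` and
   `S_U − S_1 = D_UᴴW + WᴴD_1 + (Y_U − Y_1)` (`GaugeTermResolventBounds.inv_sub_inv_eq'`, `gram_sub_gram`), every factor conjugated and `n`-uniform;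
 * §3 **`opNorm_conjMat_Z_diff_le`**: `‖c(Z_U) − c(Z_1)‖ ≤ dZc` (`Z = Q′G′D_Rᴴ`; `G′_UD_Uᴴ − G′_1D_1ᴴ = G′_UWᴴ + (G′_U − G′_1)D_1ᴴ`), and the adjoint.
Every constant carries a factor `α` or `τ`.

HONEST FRAMING (T4-DAG p. 1).  Bookkeeping over landed modules ([folklore]); statements and constants OURS; MODEL level (no B0); nothing of any NE
row estimated; the assembly (difference of the two sandwiches, `hP₄` in difference form, the `t = 1` END) is file E5b; Δ3 NOT closed; NE2 (U1a)
NOT PROVED; spine PROVED 0/9 unchanged; NOT infinite volume, NOT a mass gap, NOT the Clay problem, NOT summit progress.  HONEST DEPENDENCY: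
continuum YM on T⁴ ⇐ BetaPertH ∧ nine spine estimates (0/9 proved); BetaPertH ⇐ (D1) ∧ (D4) ∧ CAP+tail; G-an2-4 gates asym, D1 and NE2/3/4.
ABSOLUTE RULE kept; no `sorry`.
-/

noncomputable section

open scoped BigOperators ComplexConjugate Matrix Matrix.Norms.L2Operator Kronecker ComplexOrder

namespace Summit.QuantumFields.BalabanUV.T4Continuum.CTGaugeSlotDiff

open Literature.MathematicalPhysics.QuantumFieldTheory.Balaban1983to89.B5Prop11Plancherel (Tor fine shiftM unitVec)
open Literature.MathematicalPhysics.QuantumFieldTheory.Balaban1983to89.B5Action121 (GradOp)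
open Literature.MathematicalPhysics.QuantumFieldTheory.Balaban1983to89.B5Blocks16 (blockOf)
open Summit.QuantumFields.BalabanUV.T4Continuum
open Summit.QuantumFields.BalabanUV.T4Continuum.CoerciveInverseTower (Coercive isUnit_of_coercive)
open Summit.QuantumFields.BalabanUV.T4Continuum.BlockMultiplication (siteMul siteMul_apply siteMul_sub siteMul_one opNorm_siteMul_le
  siteMul_conjTranspose)
open Summit.QuantumFields.BalabanUV.T4Continuum.KroneckerLift (opNorm_kron_le_of_le sub_kronecker)
open Summit.QuantumFields.BalabanUV.T4Continuum.GaugeTermDecomposition (injM covGrad defect connL covGrad_eq covGrad_one opNorm_injM_le)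
open Summit.QuantumFields.BalabanUV.T4Continuum.GaugeTermResolventBounds (inv_sub_inv_eq' gram_sub_gram)
open Summit.QuantumFields.BalabanUV.T4Continuum.ScalarBlockPoincare (PiS)
open Summit.QuantumFields.BalabanUV.T4Continuum.ScalarCovariantLaplacian (scalarOp connS Bs opNorm_Bs_le)
open Summit.QuantumFields.BalabanUV.T4Continuum.ScalarCovariantCoercive (gammaU siteW Jcov Jcov_nonneg scalarOp_isHermitian
  opNorm_siteMul_sub_one_le opNorm_siteMul_le_one_add isUnit_scalarOp opNorm_scalarOp_inv_le gram_eq_sandwich)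
open Summit.QuantumFields.BalabanUV.T4Continuum.CTWeightedCoercivity
open Summit.QuantumFields.BalabanUV.T4Continuum.CTConjugationPieces (opNorm_conjMat_le_add conjMat_of_sameWeight conjMat_conjTranspose
  opNorm_conjMat_conjTranspose_sub_eq)
open Summit.QuantumFields.BalabanUV.T4Continuum.CTConjugationTorus (coarseW opNorm_conjMat_PiS_sub_le)
open Summit.QuantumFields.BalabanUV.T4Continuum.CTWeightedEnergy (K1 K2 K1_nonneg K2_nonneg)
open Summit.QuantumFields.BalabanUV.T4Continuum.CTConjugatedHbd (opNorm_conjMat_shiftM_le conjMat_finset_sum conjMat_neg)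
open Summit.QuantumFields.BalabanUV.T4Continuum.CTCovariantLaplacianDecay (conjMat_kron)
open Summit.QuantumFields.BalabanUV.T4Continuum.CTCovariantScalarGreen
open Summit.QuantumFields.BalabanUV.T4Continuum.CTGaugeSandwichHbd

variable {d : ℕ} (n : ℕ) [NeZero n] (M : Fin d → ℕ) [hM : ∀ μ, NeZero (M μ)]
variable {o : Type*} [Fintype o] [DecidableEq o]
variable {ρ₀ : Tor (fine n M) → ℝ} {κ a' : ℝ}
variable {R : Fin d → (Tor (fine n M) → Matrix o o ℂ)} {T : Tor (fine n M) → Matrix o o ℂ} {α τ : ℝ}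

/-! ## §1 The elementary conjugated differences -/

/-- **`‖c(W)‖ ≤ dα·e^{|κ|}`** for the defect `W = D_R − ∂⊗1 = Σ_μ siteMul(w_μ)(S_μ⊗1)(ι_μ⊗1)` (site factors and embeddings commute with the
conjugation, `‖c(S_μ)‖ ≤ e^{|κ|}` — «Δ3-CT-HBD» C1). [folklore] -/
theorem opNorm_conjMat_defect_le (hα : 0 ≤ α) (hR : ∀ μ x, ‖connS (fine n M) ((n : ℕ) : ℂ) R μ x‖ ≤ α)
    (hlip : ∀ x ν, |ρ₀ (x + unitVec (fine n M) ν) - ρ₀ x| ≤ 1 / n) (κ : ℝ) :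
    ‖conjMat κ (bondCW n M (o := o) ρ₀) (siteW n M ρ₀) (defect (fine n M) ((n : ℕ) : ℂ) R)‖ ≤ d * α * Real.exp |κ| := by
  have hn1 : 1 ≤ n := Nat.one_le_iff_ne_zero.mpr (NeZero.ne n)
  have hℓ : ∀ (x : Tor (fine n M)) (μ ν : Fin d),
      |(fun b : Tor (fine n M) × Fin d => ρ₀ b.1) (x + unitVec (fine n M) ν, μ) - (fun b : Tor (fine n M) × Fin d => ρ₀ b.1) (x, μ)| ≤ 1 / n :=
    fun x μ ν => hlip x ν
  have hS : ∀ μ, ‖conjMat κ (bondCW n M (o := o) ρ₀) (bondCW n M (o := o) ρ₀) (shiftM (fine n M) μ ⊗ₖ (1 : Matrix o o ℂ))‖ ≤ Real.exp |κ| := by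
    intro μ
    have e : conjMat κ (bondCW n M (o := o) ρ₀) (bondCW n M (o := o) ρ₀) (shiftM (fine n M) μ ⊗ₖ (1 : Matrix o o ℂ))
        = conjMat κ (fun b : Tor (fine n M) × Fin d => ρ₀ b.1) (fun b : Tor (fine n M) × Fin d => ρ₀ b.1) (shiftM (fine n M) μ)
          ⊗ₖ (1 : Matrix o o ℂ) :=
      conjMat_kron κ (fun b : Tor (fine n M) × Fin d => ρ₀ b.1) (fun b : Tor (fine n M) × Fin d => ρ₀ b.1) (shiftM (fine n M) μ)
        (1 : Matrix o o ℂ)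
    rw [e]; exact opNorm_kron_le_of_le o (opNorm_conjMat_shiftM_le n hn1 M κ hℓ μ)
  have hw : ∀ μ (i : Tor (fine n M) × Fin d), ‖connL (fine n M) ((n : ℕ) : ℂ) R μ i‖ ≤ α := fun μ i => by
    simpa [connL, connS] using hR μ i.1
  rw [defect, conjMat_finset_sum]
  have hterm : ∀ μ ∈ (Finset.univ : Finset (Fin d)),
      ‖conjMat κ (bondCW n M (o := o) ρ₀) (siteW n M ρ₀)
        (siteMul (connL (fine n M) ((n : ℕ) : ℂ) R μ) * shiftM (fine n M) μ ⊗ₖ (1 : Matrix o o ℂ) * injM (fine n M) μ ⊗ₖ (1 : Matrix o o ℂ))‖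
        ≤ α * Real.exp |κ| := by
    intro μ _
    rw [conjMat_mul κ _ (bondCW n M (o := o) ρ₀) _, conjMat_injM_kron, conjMat_mul κ _ (bondCW n M (o := o) ρ₀) _, conjMat_siteMul_bond]
    calc _ ≤ ‖siteMul (connL (fine n M) ((n : ℕ) : ℂ) R μ)
              * conjMat κ (bondCW n M (o := o) ρ₀) (bondCW n M (o := o) ρ₀) (shiftM (fine n M) μ ⊗ₖ (1 : Matrix o o ℂ))‖
            * ‖injM (fine n M) μ ⊗ₖ (1 : Matrix o o ℂ)‖ := Matrix.l2_opNorm_mul _ _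
      _ ≤ (α * Real.exp |κ|) * 1 :=
          mul_le_mul ((Matrix.l2_opNorm_mul _ _).trans (mul_le_mul (opNorm_siteMul_le _ hα (hw μ)) (hS μ) (norm_nonneg _) hα))
            (opNorm_kron_le_of_le o (opNorm_injM_le _ μ)) (norm_nonneg _) (by positivity)
      _ = α * Real.exp |κ| := mul_one _
  refine (norm_sum_le _ _).trans ((Finset.sum_le_sum hterm).trans (le_of_eq ?_))
  rw [Finset.sum_const, Finset.card_univ, Fintype.card_fin, nsmul_eq_mul, mul_assoc]

/-- the adjoint: `‖c(Wᴴ)‖ ≤ dα·e^{|κ|}`. [folklore] -/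
theorem opNorm_conjMat_defectH_le (hα : 0 ≤ α) (hR : ∀ μ x, ‖connS (fine n M) ((n : ℕ) : ℂ) R μ x‖ ≤ α)
    (hlip : ∀ x ν, |ρ₀ (x + unitVec (fine n M) ν) - ρ₀ x| ≤ 1 / n) (κ : ℝ) :
    ‖conjMat κ (siteW n M ρ₀) (bondCW n M (o := o) ρ₀) (defect (fine n M) ((n : ℕ) : ℂ) R)ᴴ‖ ≤ d * α * Real.exp |κ| := by
  rw [conjMat_conjTranspose, Matrix.l2_opNorm_conjTranspose]
  have h := opNorm_conjMat_defect_le n M (ρ₀ := ρ₀) (o := o) hα hR hlip (-κ)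
  rwa [abs_neg] at h

/-- **`‖c(Q′_U) − c(Q′_1)‖ ≤ e^{|κ|}·τ`** (`Q′_U − Q′_1 = B·siteMul(T − 1)`; block oscillation `≤ 1`). [folklore] -/
theorem opNorm_conjMat_Qu_sub_Q1_le (κ : ℝ) (hτ : 0 ≤ τ) (hosc : ∀ x x', blockOf n M x = blockOf n M x' → |ρ₀ x - ρ₀ x'| ≤ 1)
    (hT : ∀ x, ‖T x - 1‖ ≤ τ) :
    ‖conjMat κ (coarseCW n M (o := o) ρ₀) (siteW n M ρ₀) (Bs o n M * siteMul T)
        - conjMat κ (coarseCW n M (o := o) ρ₀) (siteW n M ρ₀) (Bs o n M * siteMul (fun _ : Tor (fine n M) => (1 : Matrix o o ℂ)))‖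
      ≤ Real.exp |κ| * τ := by
  rw [← conjMat_sub, ← Matrix.mul_sub, conjMat_mul κ _ (siteW n M ρ₀) _, ← siteMul_sub, conjMat_siteMul_site]
  have hB : ‖conjMat κ (coarseCW n M (o := o) ρ₀) (siteW n M ρ₀) (Bs o n M)‖ ≤ Real.exp |κ| := by
    calc _ ≤ ‖Bs o n M‖ + ‖conjMat κ (coarseCW n M (o := o) ρ₀) (siteW n M ρ₀) (Bs o n M) - Bs o n M‖ := opNorm_conjMat_le_add κ _ _ _
      _ ≤ 1 + (Real.exp (|κ| * 1) - 1) := add_le_add (opNorm_Bs_le o n M) (opNorm_conjMat_Bs_sub_le n M κ zero_le_one hosc)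
      _ = Real.exp |κ| := by rw [mul_one]; ring
  have hT' : ‖siteMul (fun i => T i - (1 : Matrix o o ℂ))‖ ≤ τ := by
    rw [siteMul_sub, siteMul_one]; exact opNorm_siteMul_sub_one_le n M hτ hT
  exact (Matrix.l2_opNorm_mul _ _).trans (mul_le_mul hB hT' (norm_nonneg _) (by positivity))

/-- the adjoint: `‖c(Q′_Uᴴ) − c(Q′_1ᴴ)‖ ≤ e^{|κ|}·τ`. [folklore] -/
theorem opNorm_conjMat_QuH_sub_Q1H_le (κ : ℝ) (hτ : 0 ≤ τ) (hosc : ∀ x x', blockOf n M x = blockOf n M x' → |ρ₀ x - ρ₀ x'| ≤ 1)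
    (hT : ∀ x, ‖T x - 1‖ ≤ τ) :
    ‖conjMat κ (siteW n M ρ₀) (coarseCW n M (o := o) ρ₀) (Bs o n M * siteMul T)ᴴ
        - conjMat κ (siteW n M ρ₀) (coarseCW n M (o := o) ρ₀) (Bs o n M * siteMul (fun _ : Tor (fine n M) => (1 : Matrix o o ℂ)))ᴴ‖
      ≤ Real.exp |κ| * τ := by
  rw [conjMat_conjTranspose, conjMat_conjTranspose, ← Matrix.conjTranspose_sub, Matrix.l2_opNorm_conjTranspose]
  have h := opNorm_conjMat_Qu_sub_Q1_le n M (ρ₀ := ρ₀) (o := o) (-κ) hτ hosc hT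
  rwa [abs_neg] at h

/-- **`‖c(Y_U − Y_1)‖ ≤ a′·e^{|κ|}·τ·(2 + τ)`** (`Y = a′(BT)ᴴ(BT) = a′·siteMul(Tᴴ)(Π′⊗1)siteMul T`;
`Y_U − Y_1 = a′[siteMul(Tᴴ)(Π′⊗1)siteMul(T − 1) + siteMul(Tᴴ − 1)(Π′⊗1)]`, `‖c(Π′⊗1)‖ ≤ e^{|κ|}`). [folklore] -/
theorem opNorm_conjMat_massDiff_le (ha' : 0 ≤ a') (κ : ℝ) (hτ : 0 ≤ τ)
    (hosc : ∀ x x', blockOf n M x = blockOf n M x' → |ρ₀ x - ρ₀ x'| ≤ 1) (hT : ∀ x, ‖T x - 1‖ ≤ τ) :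
    ‖conjMat κ (siteW n M ρ₀) (siteW n M ρ₀)
        ((a' : ℂ) • ((Bs o n M * siteMul T)ᴴ * (Bs o n M * siteMul T))
          - (a' : ℂ) • ((Bs o n M * siteMul (fun _ : Tor (fine n M) => (1 : Matrix o o ℂ)))ᴴ
              * (Bs o n M * siteMul (fun _ : Tor (fine n M) => (1 : Matrix o o ℂ)))))‖
      ≤ a' * Real.exp |κ| * τ * (2 + τ) := by
  have hP : ‖conjMat κ (siteW n M ρ₀) (siteW n M ρ₀) (PiS n M ⊗ₖ (1 : Matrix o o ℂ))‖ ≤ Real.exp |κ| := by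
    have e : conjMat κ (siteW n M ρ₀) (siteW n M ρ₀) (PiS n M ⊗ₖ (1 : Matrix o o ℂ)) = conjMat κ ρ₀ ρ₀ (PiS n M) ⊗ₖ (1 : Matrix o o ℂ) :=
      conjMat_kron κ ρ₀ ρ₀ (PiS n M) (1 : Matrix o o ℂ)
    have hsub : ‖conjMat κ (siteW n M ρ₀) (siteW n M ρ₀) (PiS n M ⊗ₖ (1 : Matrix o o ℂ)) - PiS n M ⊗ₖ (1 : Matrix o o ℂ)‖
        ≤ Real.exp (|κ| * 1) - 1 := by
      rw [e, ← sub_kronecker]; exact opNorm_kron_le_of_le o (opNorm_conjMat_PiS_sub_le n M κ zero_le_one hosc)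
    have hone : ‖PiS n M ⊗ₖ (1 : Matrix o o ℂ)‖ ≤ 1 := by
      rw [← ScalarCovariantLaplacian.Bs_conjTranspose_mul_Bs (o := o)]
      calc _ ≤ ‖(Bs o n M)ᴴ‖ * ‖Bs o n M‖ := Matrix.l2_opNorm_mul _ _
        _ ≤ 1 * 1 := mul_le_mul (by rw [Matrix.l2_opNorm_conjTranspose]; exact opNorm_Bs_le o n M) (opNorm_Bs_le o n M)
            (norm_nonneg _) zero_le_one
        _ = 1 := one_mul _
    calc _ ≤ ‖PiS n M ⊗ₖ (1 : Matrix o o ℂ)‖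
          + ‖conjMat κ (siteW n M ρ₀) (siteW n M ρ₀) (PiS n M ⊗ₖ (1 : Matrix o o ℂ)) - PiS n M ⊗ₖ (1 : Matrix o o ℂ)‖ :=
          opNorm_conjMat_le_add κ _ _ _
      _ ≤ 1 + (Real.exp (|κ| * 1) - 1) := add_le_add hone hsub
      _ = Real.exp |κ| := by rw [mul_one]; ring
  have hTH : ∀ x, ‖(fun x => (T x)ᴴ) x - 1‖ ≤ τ := fun x => by
    show ‖(T x)ᴴ - 1‖ ≤ τ
    rw [← Matrix.conjTranspose_one, ← Matrix.conjTranspose_sub, Matrix.l2_opNorm_conjTranspose]; exact hT x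
  have h1T : ‖siteMul (fun x => (T x)ᴴ)‖ ≤ 1 + τ := opNorm_siteMul_le_one_add n M hτ hTH
  have hTsub : ‖siteMul (fun i => T i - (1 : Matrix o o ℂ))‖ ≤ τ := by
    rw [siteMul_sub, siteMul_one]; exact opNorm_siteMul_sub_one_le n M hτ hT
  have hTHsub : ‖siteMul (fun i => (T i)ᴴ - (1 : Matrix o o ℂ))‖ ≤ τ := by
    rw [siteMul_sub, siteMul_one]; exact opNorm_siteMul_sub_one_le n M hτ hTH
  -- the algebra
  have e1 : (Bs o n M * siteMul (fun _ : Tor (fine n M) => (1 : Matrix o o ℂ)))ᴴ * (Bs o n M * siteMul (fun _ : Tor (fine n M) => (1 : Matrix o o ℂ)))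
      = PiS n M ⊗ₖ (1 : Matrix o o ℂ) := by
    rw [siteMul_one, Matrix.mul_one, ScalarCovariantLaplacian.Bs_conjTranspose_mul_Bs]
  have e2 : (a' : ℂ) • ((Bs o n M * siteMul T)ᴴ * (Bs o n M * siteMul T)) - (a' : ℂ) • (PiS n M ⊗ₖ (1 : Matrix o o ℂ))
      = (a' : ℂ) • (siteMul (fun x => (T x)ᴴ) * (PiS n M ⊗ₖ (1 : Matrix o o ℂ)) * siteMul (fun i => T i - (1 : Matrix o o ℂ))
          + siteMul (fun i => (T i)ᴴ - (1 : Matrix o o ℂ)) * (PiS n M ⊗ₖ (1 : Matrix o o ℂ))) := by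
    rw [gram_eq_sandwich, ← smul_sub, siteMul_sub, siteMul_sub, siteMul_one]
    congr 1
    simp only [Matrix.mul_sub, Matrix.sub_mul, Matrix.mul_one, Matrix.one_mul]
    abel
  rw [e1, e2, conjMat_smul, norm_smul, Complex.norm_real, Real.norm_of_nonneg ha', conjMat_add,
    conjMat_mul κ _ (siteW n M ρ₀) _, conjMat_mul κ _ (siteW n M ρ₀) _, conjMat_mul κ _ (siteW n M ρ₀) _,
    conjMat_siteMul_site, conjMat_siteMul_site, conjMat_siteMul_site]
  have hE : 0 ≤ Real.exp |κ| := (Real.exp_pos _).le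
  rw [show a' * Real.exp |κ| * τ * (2 + τ) = a' * ((1 + τ) * Real.exp |κ| * τ + τ * Real.exp |κ|) by ring]
  refine mul_le_mul_of_nonneg_left ((norm_add_le _ _).trans (add_le_add ?_ ?_)) ha'
  · exact (Matrix.l2_opNorm_mul _ _).trans (mul_le_mul ((Matrix.l2_opNorm_mul _ _).trans (mul_le_mul h1T hP (norm_nonneg _)
      (by positivity))) hTsub (norm_nonneg _) (by positivity))
  · exact (Matrix.l2_opNorm_mul _ _).trans (mul_le_mul hTHsub hP (norm_nonneg _) hτ)

/-! ## §2 The conjugated Green-function differences (resolvent identity, every factor `n`-uniform) -/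

/-- the bound of `‖c(G′_U) − c(G′_1)‖`: `dGc = K₂(U)·w·γ₁⁻¹ + γ_U⁻¹·w·(√(1/γ₁ + J₁/γ₁²) + cR₁/γ₁) + γ_U⁻¹·y·γ₁⁻¹`
(`w = dαe^{|κ|}`, `y = a′e^{|κ|}τ(2+τ)`, `γ_U = gammaU(α,τ) − Jcov(α,τ,κ)`, `γ₁ = gammaU(0,0) − Jcov(0,0,κ)`, `cR₁ = cR d 0 κ`). [folklore] -/
def dGc (co d : ℕ) (a' α τ κ : ℝ) : ℝ :=
  K2 (gammaU d a' α τ - Jcov co d a' α τ κ) (Jcov co d a' α τ κ) (cR d α κ) * (d * α * Real.exp |κ|)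
      * (gammaU d a' 0 0 - Jcov co d a' 0 0 κ)⁻¹
    + (gammaU d a' α τ - Jcov co d a' α τ κ)⁻¹ * (d * α * Real.exp |κ|)
      * (Real.sqrt (1 / (gammaU d a' 0 0 - Jcov co d a' 0 0 κ) + Jcov co d a' 0 0 κ / (gammaU d a' 0 0 - Jcov co d a' 0 0 κ) ^ 2)
        + cR d 0 κ / (gammaU d a' 0 0 - Jcov co d a' 0 0 κ))
    + (gammaU d a' α τ - Jcov co d a' α τ κ)⁻¹ * (a' * Real.exp |κ| * τ * (2 + τ)) * (gammaU d a' 0 0 - Jcov co d a' 0 0 κ)⁻¹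

/-- **`‖c(G′_U) − c(G′_1)‖ ≤ dGc`** — VANISHING with the background. [folklore] -/
theorem opNorm_conjMat_green_diff_le (ha' : 0 < a') (hα : 0 ≤ α) (hτ : 0 ≤ τ)
    (hR : ∀ μ x, ‖connS (fine n M) ((n : ℕ) : ℂ) R μ x‖ ≤ α) (hT : ∀ x, ‖T x - 1‖ ≤ τ)
    (hlip : ∀ x ν, |ρ₀ (x + unitVec (fine n M) ν) - ρ₀ x| ≤ 1 / n) (hosc : ∀ x x', blockOf n M x = blockOf n M x' → |ρ₀ x - ρ₀ x'| ≤ 1)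
    (hγU : 0 < gammaU d a' α τ - Jcov (Fintype.card o) d a' α τ κ) (hγ1 : 0 < gammaU d a' 0 0 - Jcov (Fintype.card o) d a' 0 0 κ) :
    ‖conjMat κ (siteW n M ρ₀) (siteW n M ρ₀) (scalarOp n M a' R T)⁻¹
        - conjMat κ (siteW n M ρ₀) (siteW n M ρ₀) (scalarOp n M a' (fun _ _ => (1 : Matrix o o ℂ)) (fun _ => 1))⁻¹‖
      ≤ dGc (Fintype.card o) d a' α τ κ := by
  -- names and presentations
  set Su := scalarOp n M a' R T with hSu
  set S₁ := scalarOp n M a' (fun _ _ => (1 : Matrix o o ℂ)) (fun _ => 1) with hS₁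
  set DU := covGrad (fine n M) ((n : ℕ) : ℂ) R with hDU
  set D₁ := covGrad (fine n M) ((n : ℕ) : ℂ) (fun (_ : Fin d) (_ : Tor (fine n M)) => (1 : Matrix o o ℂ)) with hD₁
  set W := defect (fine n M) ((n : ℕ) : ℂ) R with hW
  set Yu := (a' : ℂ) • ((Bs o n M * siteMul T)ᴴ * (Bs o n M * siteMul T)) with hYu
  set Y₁ := (a' : ℂ) • ((Bs o n M * siteMul (fun _ : Tor (fine n M) => (1 : Matrix o o ℂ)))ᴴ
    * (Bs o n M * siteMul (fun _ : Tor (fine n M) => (1 : Matrix o o ℂ)))) with hY₁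
  set ρS := siteW n M (o := o) ρ₀
  set ρB := bondCW n M (o := o) ρ₀
  have h0R : ∀ μ x, ‖connS (fine n M) ((n : ℕ) : ℂ) (fun (_ : Fin d) (_ : Tor (fine n M)) => (1 : Matrix o o ℂ)) μ x‖ ≤ 0 :=
    fun μ x => by simp [connS]
  have h0T : ∀ x : Tor (fine n M), ‖(fun _ : Tor (fine n M) => (1 : Matrix o o ℂ)) x - 1‖ ≤ 0 := fun x => by simp
  have hD₁G : D₁ = GradOp (fine n M) ((n : ℕ) : ℂ) ⊗ₖ (1 : Matrix o o ℂ) := covGrad_one _ _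
  have hDUW : DU = D₁ + W := by rw [hDU, covGrad_eq, hD₁G]
  have hSug : Su = DUᴴ * DU + Yu := scalarOp_eq_gram n M a' R T
  have hS₁g : S₁ = D₁ᴴ * D₁ + Y₁ := by
    rw [hS₁, scalarOp_eq_gram, siteMul_one, Matrix.mul_one]; rw [hY₁, siteMul_one, Matrix.mul_one]
  have hγU0 : 0 < gammaU d a' α τ := lt_of_lt_of_le hγU (sub_le_self _ (Jcov_nonneg _ _ ha'.le hα κ))
  have hγ10 : 0 < gammaU d a' 0 0 := lt_of_lt_of_le hγ1 (sub_le_self _ (Jcov_nonneg _ _ ha'.le le_rfl κ))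
  have hSuU : IsUnit Su.det := (Matrix.isUnit_iff_isUnit_det Su).mp (isUnit_scalarOp n M ha' hα hτ hR hT hγU0)
  have hS₁U : IsUnit S₁.det := (Matrix.isUnit_iff_isUnit_det S₁).mp (isUnit_scalarOp n M ha' le_rfl le_rfl h0R h0T hγ10)
  -- the resolvent identity
  have e1 : Su⁻¹ - S₁⁻¹ = -((Su⁻¹ * DUᴴ) * (W * S₁⁻¹) + (Su⁻¹ * Wᴴ) * (D₁ * S₁⁻¹) + Su⁻¹ * (Yu - Y₁) * S₁⁻¹) := by
    have hd : S₁ - Su = -(DUᴴ * W + Wᴴ * D₁ + (Yu - Y₁)) := by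
      rw [← neg_sub, hSug, hS₁g, hDUW, gram_sub_gram]
    rw [inv_sub_inv_eq' hSuU hS₁U, hd]
    simp only [Matrix.mul_neg, Matrix.neg_mul, Matrix.mul_add, Matrix.add_mul, Matrix.mul_assoc]
  rw [← conjMat_sub, e1, conjMat_neg, norm_neg, conjMat_add, conjMat_add, conjMat_mul κ ρS ρB ρS (Su⁻¹ * DUᴴ),
    conjMat_mul κ ρB ρS ρS W, conjMat_mul κ ρS ρB ρS (Su⁻¹ * Wᴴ), conjMat_mul κ ρS ρS ρB Su⁻¹ Wᴴ,
    conjMat_mul κ ρS ρS ρS (Su⁻¹ * (Yu - Y₁)), conjMat_mul κ ρS ρS ρS Su⁻¹]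
  -- the factor bounds
  have hK2 := opNorm_conjMat_inv_covGradH_le n M (ρ₀ := ρ₀) (κ := κ) ha' hα hτ hR hT hlip hosc hγU
  have hw := opNorm_conjMat_defect_le n M (ρ₀ := ρ₀) (o := o) hα hR hlip κ
  have hwH := opNorm_conjMat_defectH_le n M (ρ₀ := ρ₀) (o := o) hα hR hlip κ
  have hG1 := opNorm_conjMat_scalarOp_inv_le n M (ρ₀ := ρ₀) (κ := κ) ha' le_rfl le_rfl h0R h0T hlip hosc hγ1
  have hGU := opNorm_conjMat_scalarOp_inv_le n M (ρ₀ := ρ₀) (κ := κ) ha' hα hτ hR hT hlip hosc hγU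
  have hDG1 := opNorm_conjMat_covGrad_inv_le n M (ρ₀ := ρ₀) (κ := κ) ha' le_rfl le_rfl h0R h0T hlip hosc hγ1
  have hY := opNorm_conjMat_massDiff_le n M (ρ₀ := ρ₀) (o := o) ha'.le κ hτ hosc hT
  have h0w : 0 ≤ d * α * Real.exp |κ| := by positivity
  have hK2nn := K2_nonneg (gammaU d a' α τ - Jcov (Fintype.card o) d a' α τ κ) (Jcov (Fintype.card o) d a' α τ κ) (cR d α κ)
  refine (norm_add_le _ _).trans ((add_le_add ((norm_add_le _ _).trans (add_le_add ?_ ?_)) ?_).trans (le_of_eq (by rw [dGc])))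
  · exact ((Matrix.l2_opNorm_mul _ _).trans (mul_le_mul hK2 ((Matrix.l2_opNorm_mul _ _).trans (mul_le_mul hw hG1 (norm_nonneg _) h0w))
      (norm_nonneg _) hK2nn)).trans (le_of_eq (by ring))
  · calc _ ≤ ‖conjMat κ ρS ρS Su⁻¹ * conjMat κ ρS ρB Wᴴ‖ * ‖conjMat κ ρB ρS (D₁ * S₁⁻¹)‖ := Matrix.l2_opNorm_mul _ _
      _ ≤ ((gammaU d a' α τ - Jcov (Fintype.card o) d a' α τ κ)⁻¹ * (d * α * Real.exp |κ|))
          * (Real.sqrt (1 / (gammaU d a' 0 0 - Jcov (Fintype.card o) d a' 0 0 κ)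
              + Jcov (Fintype.card o) d a' 0 0 κ / (gammaU d a' 0 0 - Jcov (Fintype.card o) d a' 0 0 κ) ^ 2)
            + cR d 0 κ / (gammaU d a' 0 0 - Jcov (Fintype.card o) d a' 0 0 κ)) :=
          mul_le_mul ((Matrix.l2_opNorm_mul _ _).trans (mul_le_mul hGU hwH (norm_nonneg _) (by positivity))) hDG1 (norm_nonneg _)
            (by positivity)
  · calc _ ≤ ‖conjMat κ ρS ρS Su⁻¹ * conjMat κ ρS ρS (Yu - Y₁)‖ * ‖conjMat κ ρS ρS S₁⁻¹‖ := Matrix.l2_opNorm_mul _ _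
      _ ≤ ((gammaU d a' α τ - Jcov (Fintype.card o) d a' α τ κ)⁻¹ * (a' * Real.exp |κ| * τ * (2 + τ)))
          * (gammaU d a' 0 0 - Jcov (Fintype.card o) d a' 0 0 κ)⁻¹ :=
          mul_le_mul ((Matrix.l2_opNorm_mul _ _).trans (mul_le_mul hGU hY (norm_nonneg _) (by positivity))) hG1 (norm_nonneg _)
            (by positivity)

end Summit.QuantumFields.BalabanUV.T4Continuum.CTGaugeSlotDiff

end
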